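import Summits.HubbardSuperconductivity.HubbardSuperconductivity.Theorems.ThermalWedgeTwSeededEnsembleEquivalenceRSelectionTransfer
import Summits.HubbardSuperconductivity.HubbardSuperconductivity.Theorems.ThermalWedgeTwSeededEnsembleEquivalenceRPbSectorSelection
import Summits.HubbardSuperconductivity.HubbardSuperconductivity.Theorems.ThermalWedgeTwSeededEnsembleEquivalenceRSectorWeightLipschitz
import Summits.HubbardSuperconductivity.HubbardSuperconductivity.Theorems.ThermalWedgeTwSeededEnsembleEquivalenceSectorWeightBasics
import Summits.HubbardSuperconductivity.HubbardSuperconductivity.Theorems.ThermalWedgeTwSeededEnsembleEquivalenceRSeededSectorCalculus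
import Summits.HubbardSuperconductivity.HubbardSuperconductivity.Theorems.ThermalWedgeTwSeededEnsembleEquivalenceRTrialStateBudget

/-!
# Crux `TwSeededEnsembleEquivalenceR` (stmt-HubbardSuperconductivity-15581), line `cold-floor-collapse` (slug `Sketch`),
# skeleton v8 (block two-phase pinning) — registered stub `stub_twoPhaseCore`

Support file (`--supports stmt-HubbardSuperconductivity-15581`; sorry-free; no definition).
The finite-volume two-phase bound at fixed (β,U,g,μ*,h₀): ASSEMBLY of S7h `stub_seededSectorCalculus` (sector calculus),
S7i `stub_trialStateBudget` (trial state + budget) and S7g `stub_selectionTransfer` (optimised penalty).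
-/

set_option linter.dupNamespace false

namespace Summit.HubbardSuperconductivity.HubbardSuperconductivity.Theorems.TwSeededEnsembleEquivalenceR.ColdFloorLine

open Matrix Filter Topology Finset Literature.MathematicalPhysics.QuantumLattice
open Literature.Barriers.HubbardSuperconductivity Literature.Probability.LatticeModels
open scoped ComplexOrder Matrix.Norms.L2Operator

noncomputable section

/-! ### Helpers (pure real arithmetic for the assembly) -/

/-- The tuned auxiliary accuracy `ε₁` fed to the trial-state budget: positive and below the five explicit caps used below. -/
private theorem tp_eps (β ε D : ℝ) (hβ : 0 < β) (hε : 0 < ε) (hD : 0 < D) :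
    ∃ ε₁ : ℝ, 0 < ε₁ ∧ ε₁ ≤ ε / 4 ∧ ε₁ ≤ (β * ε / (8 * D)) ^ 2 ∧ ε₁ ≤ 1 / 1600 ∧
      ε₁ ≤ D / (3200 * β) ∧ ε₁ ≤ (D / 3200) ^ 2 := by
  refine ⟨min (ε / 4) (min ((β * ε / (8 * D)) ^ 2) (min (1 / 1600) (min (D / (3200 * β)) ((D / 3200) ^ 2)))),
    by positivity, min_le_left _ _, (min_le_right _ _).trans (min_le_left _ _),
    (min_le_right _ _).trans ((min_le_right _ _).trans (min_le_left _ _)),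
    (min_le_right _ _).trans ((min_le_right _ _).trans ((min_le_right _ _).trans (min_le_left _ _))),
    (min_le_right _ _).trans ((min_le_right _ _).trans ((min_le_right _ _).trans (min_le_right _ _)))⟩

/-- `√(max V 1) ≤ sY + 1` as soon as `V ≤ s²Y²` (`s, Y ≥ 0`). -/
private theorem tp_sqrt_bound (V s Y : ℝ) (hs : 0 ≤ s) (hY : 0 ≤ Y) (hV : V ≤ s ^ 2 * Y ^ 2) :
    Real.sqrt (max V 1) ≤ s * Y + 1 := by
  rw [Real.sqrt_le_left (by positivity)]
  have hsY : 0 ≤ s * Y := mul_nonneg hs hY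
  exact max_le (by nlinarith) (by nlinarith)

/-- Window bookkeeping for the optimiser: with `X = L²`, `N₁ = ⌊(X+1)/2⌋`, `N₂ = ⌊3X/2⌋ − 1`, `N_c = 2⌊(1−δ)X/2⌋`,
`m = X/10 − 3` and `δ ∈ [1/10, 2/5]`: `N₁ + m ≤ N_c`, `N_c + m ≤ N₂`, `N_c ≤ 2L²`. -/
private theorem tp_window (L : ℕ) (δ : ℝ) (hδ : δ ∈ Set.Icc (1/10 : ℝ) (2/5 : ℝ)) :
    ((((L ^ 2 + 1) / 2 : ℕ) : ℝ) + ((L : ℝ) ^ 2 / 10 - 3) ≤ ((2 * ⌊(1 - δ) * (L : ℝ) ^ 2 / 2⌋₊ : ℕ) : ℝ)) ∧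
    (((2 * ⌊(1 - δ) * (L : ℝ) ^ 2 / 2⌋₊ : ℕ) : ℝ) + ((L : ℝ) ^ 2 / 10 - 3) ≤ ((3 * L ^ 2 / 2 - 1 : ℕ) : ℝ)) ∧
    2 * ⌊(1 - δ) * (L : ℝ) ^ 2 / 2⌋₊ ≤ 2 * L ^ 2 := by
  obtain ⟨hδ1, hδ2⟩ := hδ
  have hX0 : (0 : ℝ) ≤ (L : ℝ) ^ 2 := by positivity
  have hd0 : (0 : ℝ) ≤ 1 - δ := by linarith
  have hy0 : (0 : ℝ) ≤ (1 - δ) * (L : ℝ) ^ 2 / 2 := by positivity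
  have hF1 : (⌊(1 - δ) * (L : ℝ) ^ 2 / 2⌋₊ : ℝ) ≤ (1 - δ) * (L : ℝ) ^ 2 / 2 := Nat.floor_le hy0
  have hF2 : (1 - δ) * (L : ℝ) ^ 2 / 2 < (⌊(1 - δ) * (L : ℝ) ^ 2 / 2⌋₊ : ℝ) + 1 := Nat.lt_floor_add_one _
  have hδX1 : 0 ≤ (δ - 1 / 10) * (L : ℝ) ^ 2 := mul_nonneg (by linarith) hX0
  have hδX2 : 0 ≤ (2 / 5 - δ) * (L : ℝ) ^ 2 := mul_nonneg (by linarith) hX0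
  obtain ⟨N₁, hN₁⟩ : ∃ N₁ : ℕ, N₁ = (L ^ 2 + 1) / 2 := ⟨_, rfl⟩
  have hN₁r : 2 * (N₁ : ℝ) ≤ (L : ℝ) ^ 2 + 1 := by
    have h : 2 * N₁ ≤ L ^ 2 + 1 := by omega
    exact_mod_cast h
  obtain ⟨N₂, hN₂⟩ : ∃ N₂ : ℕ, N₂ = 3 * L ^ 2 / 2 - 1 := ⟨_, rfl⟩
  have hN₂r : 3 * (L : ℝ) ^ 2 ≤ 2 * (N₂ : ℝ) + 3 := by
    have h : 3 * L ^ 2 ≤ 2 * N₂ + 3 := by omega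
    exact_mod_cast h
  rw [← hN₁, ← hN₂]
  refine ⟨?_, ?_, ?_⟩
  · push_cast; nlinarith
  · push_cast; nlinarith
  · have h : (2 : ℝ) * (⌊(1 - δ) * (L : ℝ) ^ 2 / 2⌋₊ : ℝ) ≤ 2 * (L : ℝ) ^ 2 := by nlinarith
    have h' : ((2 * ⌊(1 - δ) * (L : ℝ) ^ 2 / 2⌋₊ : ℕ) : ℝ) ≤ ((2 * L ^ 2 : ℕ) : ℝ) := by push_cast; linarith
    exact_mod_cast h'

/-- The smallness hypothesis of `stub_selectionTransfer` from the trial budget: with `A' ≤ βε₁X`, `V' ≤ ε₁X² + 1`,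
`√V' ≤ sX + 1`, `ℓ ≤ 2X` and the caps on `ε₁, s = √ε₁`, for `X ≥ (400/3)(2 + 4/D)`:
`2A'√V'/D + V' + 2ℓ√V'/D ≤ (X/10 − 3)²`. -/
private theorem tp_smallness (X A' V' sV ℓ D β ε₁ s : ℝ) (hD : 0 < D) (hβ : 0 < β) (hX : 0 ≤ X)
    (hR : 400 / 3 * (2 + 4 / D) ≤ X)
    (hε₁0 : 0 ≤ ε₁) (hε₁3 : ε₁ ≤ 1 / 1600) (hε₁4 : ε₁ ≤ D / (3200 * β))
    (hs0 : 0 ≤ s) (hs1 : s ≤ 1) (hsB : s ≤ D / 3200)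
    (hA0 : 0 ≤ A') (hA : A' ≤ β * ε₁ * X) (hV1 : 1 ≤ V') (hV : V' ≤ ε₁ * X ^ 2 + 1)
    (hsV0 : 0 ≤ sV) (hsV : sV ≤ s * X + 1) (hℓ0 : 0 ≤ ℓ) (hℓ : ℓ ≤ 2 * X) :
    2 * A' * sV / D + V' + 2 * ℓ * sV / D ≤ (X / 10 - 3) ^ 2 := by
  have hDne : D ≠ 0 := hD.ne'
  have hβne : β ≠ 0 := hβ.ne'
  have hsX : 0 ≤ s * X := mul_nonneg hs0 hX
  have hp : β * ε₁ ≤ D / 3200 := by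
    calc β * ε₁ ≤ β * (D / (3200 * β)) := mul_le_mul_of_nonneg_left hε₁4 hβ.le
      _ = D / 3200 := by field_simp
  have hp0 : 0 ≤ β * ε₁ := mul_nonneg hβ.le hε₁0
  have h1 : A' * sV ≤ (β * ε₁ * X) * (s * X + 1) := mul_le_mul hA hsV hsV0 (by positivity)
  have h2 : ℓ * sV ≤ (2 * X) * (s * X + 1) := mul_le_mul hℓ hsV hsV0 (by positivity)
  have h3 : D * V' ≤ D * (ε₁ * X ^ 2 + 1) := mul_le_mul_of_nonneg_left hV hD.le
  have e1 : β * ε₁ * s ≤ D / 3200 := by nlinarith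
  have e2 : ε₁ * D ≤ D / 1600 := by nlinarith
  have e3 : β * ε₁ * s * X ^ 2 ≤ D / 3200 * X ^ 2 := mul_le_mul_of_nonneg_right e1 (by positivity)
  have e4 : ε₁ * D * X ^ 2 ≤ D / 1600 * X ^ 2 := mul_le_mul_of_nonneg_right e2 (by positivity)
  have e5 : s * X ^ 2 ≤ D / 3200 * X ^ 2 := mul_le_mul_of_nonneg_right hsB (by positivity)
  have e6 : β * ε₁ * X ≤ D / 3200 * X := mul_le_mul_of_nonneg_right hp hX
  have e7a : 3 * D / 400 * (400 / 3 * (2 + 4 / D)) = 2 * D + 4 := by field_simp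
  have e7b : 3 * D / 400 * (400 / 3 * (2 + 4 / D)) ≤ 3 * D / 400 * X :=
    mul_le_mul_of_nonneg_left hR (by positivity)
  have e7 : (2 * D + 4) * X ≤ 3 * D / 400 * X * X := mul_le_mul_of_nonneg_right (by linarith) hX
  have key : 2 * (β * ε₁ * X * (s * X + 1)) + D * (ε₁ * X ^ 2 + 1) + 2 * (2 * X * (s * X + 1)) ≤
      D * (X / 10 - 3) ^ 2 := by
    nlinarith [e3, e4, e5, e6, e7]
  have hDl : 2 * A' * sV / D + V' + 2 * ℓ * sV / D = (2 * (A' * sV) + D * V' + 2 * (ℓ * sV)) / D := by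
    field_simp
  rw [hDl, div_le_iff₀ hD]
  nlinarith [h1, h2, h3, key]

/-- The final budget: `A' + ℓ + D√V' ≤ βεL²` once `A' ≤ βε₁L²`, `ε₁ ≤ ε/4`, `√V' ≤ sL² + 1`, `Ds ≤ βε/8`,
`ℓ ≤ 2L + D` and `L ≥ 4(1 + D)/(βε)`. -/
private theorem tp_final (L A' sV ℓ D β ε ε₁ s : ℝ) (hD : 0 < D) (hβ : 0 < β) (hε : 0 < ε) (hL : 1 ≤ L)
    (hR : 4 * (1 + D) / (β * ε) ≤ L) (hε₁1 : ε₁ ≤ ε / 4) (hsA : s ≤ β * ε / (8 * D))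
    (hA : A' ≤ β * ε₁ * L ^ 2) (hsV : sV ≤ s * L ^ 2 + 1) (hℓ : ℓ ≤ 2 * L + D) :
    A' + ℓ + D * sV ≤ β * ε * L ^ 2 := by
  have hDne : D ≠ 0 := hD.ne'
  have hβne : β ≠ 0 := hβ.ne'
  have hεne : ε ≠ 0 := hε.ne'
  have hX0 : 0 ≤ L ^ 2 := by positivity
  have h1 : β * ε₁ * L ^ 2 ≤ β * (ε / 4) * L ^ 2 :=
    mul_le_mul_of_nonneg_right (mul_le_mul_of_nonneg_left hε₁1 hβ.le) hX0
  have h2 : D * sV ≤ D * (s * L ^ 2 + 1) := mul_le_mul_of_nonneg_left hsV hD.le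
  have h3 : D * s ≤ β * ε / 8 := by
    calc D * s ≤ D * (β * ε / (8 * D)) := mul_le_mul_of_nonneg_left hsA hD.le
      _ = β * ε / 8 := by field_simp
  have h4 : D * s * L ^ 2 ≤ β * ε / 8 * L ^ 2 := mul_le_mul_of_nonneg_right h3 hX0
  have h5 : 1 + D ≤ β * ε / 4 * L := by
    calc (1 + D) = β * ε / 4 * (4 * (1 + D) / (β * ε)) := by field_simp
      _ ≤ β * ε / 4 * L := mul_le_mul_of_nonneg_left hR (by positivity)
  have h6 : (1 + D) * L ≤ β * ε / 4 * L * L := mul_le_mul_of_nonneg_right h5 (by linarith)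
  have h7 : 0 ≤ D * (L - 1) := mul_nonneg hD.le (by linarith)
  have h8 : 0 ≤ β * ε * L ^ 2 := by positivity
  nlinarith [h1, h2, h4, h6, h7, h8]

/-- **Abstract two-phase core.** For sector weights `W` on the `L × L` torus with positivity up to `2L²`, the
`D`-log-Lipschitz bound on the middle window, the penalised Peierls–Bogoliubov selection principle with gap `A` and
number fluctuation `V` about `N_L = 2⌊(1−δ)L²/2⌋`, and the trial budget `A ≤ βε₁L²`, `V ≤ ε₁L⁴` at the tuned `ε₁`:
`log (Z / W(N_L)) ≤ βεL²` for `L` beyond the two explicit thresholds (via `stub_selectionTransfer`). -/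
private theorem tp_core (W : ℕ → ℝ) (L : ℕ) (β ε ε₁ δ D Z A V : ℝ)
    (hβ : 0 < β) (hε : 0 < ε) (hδ : δ ∈ Set.Icc (1/10 : ℝ) (2/5 : ℝ)) (hD0 : 0 < D) (hD3 : Real.log 3 ≤ D)
    (hε₁0 : 0 < ε₁) (hε₁1 : ε₁ ≤ ε / 4) (hε₁2 : ε₁ ≤ (β * ε / (8 * D)) ^ 2) (hε₁3 : ε₁ ≤ 1 / 1600)
    (hε₁4 : ε₁ ≤ D / (3200 * β)) (hε₁5 : ε₁ ≤ (D / 3200) ^ 2)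
    (hL : 1 ≤ (L : ℝ)) (hR₁ : 4 * (1 + D) / (β * ε) ≤ L) (hR₂ : 400 / 3 * (2 + 4 / D) ≤ (L : ℝ))
    (hpos : ∀ N : ℕ, N ≤ 2 * L ^ 2 → 0 < W N)
    (hLip : ∀ N : ℕ, L ^ 2 ≤ 2 * N → 2 * (N + 1) ≤ 3 * L ^ 2 →
      |Real.log (W (N + 1)) - Real.log (W N)| ≤ D)
    (hA : A ≤ β * ε₁ * (L : ℝ) ^ 2) (hV : V ≤ ε₁ * (L : ℝ) ^ 4)
    (hsel : ∀ t : ℝ, 0 ≤ t → ∃ N : ℕ, N ≤ 2 * L ^ 2 ∧ W N ≤ Z ∧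
      Real.log Z - Real.log (W N) ≤ A + t * V + Real.log (2 * (L : ℝ) ^ 2 + 1) -
        t * ((N : ℝ) - ((2 * ⌊(1 - δ) * (L : ℝ) ^ 2 / 2⌋₊ : ℕ) : ℝ)) ^ 2) :
    Real.log (Z / W (2 * ⌊(1 - δ) * (L : ℝ) ^ 2 / 2⌋₊)) ≤ β * ε * (L : ℝ) ^ 2 := by
  -- sizes
  have hX0 : (0 : ℝ) ≤ (L : ℝ) ^ 2 := by positivity
  have hL0 : (0 : ℝ) < L := by linarith
  have hLX : (L : ℝ) ≤ (L : ℝ) ^ 2 := by nlinarith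
  have h4D : (0 : ℝ) ≤ 4 / D := by positivity
  have hX30 : (30 : ℝ) ≤ (L : ℝ) ^ 2 := by nlinarith
  -- `s = √ε₁`
  set s := Real.sqrt ε₁ with hs_def
  have hs0 : 0 ≤ s := Real.sqrt_nonneg _
  have hs2 : s ^ 2 = ε₁ := Real.sq_sqrt hε₁0.le
  have hsA : s ≤ β * ε / (8 * D) := by
    rw [hs_def, ← Real.sqrt_sq (by positivity : (0 : ℝ) ≤ β * ε / (8 * D))]
    exact Real.sqrt_le_sqrt hε₁2
  have hsB : s ≤ D / 3200 := by
    rw [hs_def, ← Real.sqrt_sq (by positivity : (0 : ℝ) ≤ D / 3200)]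
    exact Real.sqrt_le_sqrt hε₁5
  have hs1 : s ≤ 1 := by nlinarith
  -- the trial budget in the optimiser's currency
  have hA' : max A 0 ≤ β * ε₁ * (L : ℝ) ^ 2 := max_le hA (by positivity)
  have hε₁X : 0 ≤ ε₁ * ((L : ℝ) ^ 2) ^ 2 := by positivity
  have hV' : max V 1 ≤ ε₁ * ((L : ℝ) ^ 2) ^ 2 + 1 := max_le (by nlinarith [hV]) (by linarith)
  have hsqrt : Real.sqrt (max V 1) ≤ s * (L : ℝ) ^ 2 + 1 :=
    tp_sqrt_bound V s ((L : ℝ) ^ 2) hs0 hX0 (by rw [hs2]; nlinarith [hV])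
  have hℓ0 : 0 ≤ Real.log (2 * (L : ℝ) ^ 2 + 1) := Real.log_nonneg (by linarith)
  have hℓ2 : Real.log (2 * (L : ℝ) ^ 2 + 1) ≤ 2 * (L : ℝ) ^ 2 := by
    have := Real.log_le_sub_one_of_pos (by positivity : (0 : ℝ) < 2 * (L : ℝ) ^ 2 + 1); linarith
  have hℓL : Real.log (2 * (L : ℝ) ^ 2 + 1) ≤ 2 * (L : ℝ) + D := by
    have h1 : Real.log (2 * (L : ℝ) ^ 2 + 1) ≤ Real.log (3 * (L : ℝ) ^ 2) :=
      Real.log_le_log (by positivity) (by linarith)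
    have h2 : Real.log (3 * (L : ℝ) ^ 2) = Real.log 3 + 2 * Real.log L := by
      rw [Real.log_mul (by norm_num) (pow_pos hL0 2).ne', Real.log_pow]; push_cast; ring
    have h3 : Real.log (L : ℝ) ≤ (L : ℝ) - 1 := Real.log_le_sub_one_of_pos hL0
    linarith
  -- the window and positivity
  obtain ⟨hw1, hw2, hw3⟩ := tp_window L δ hδ
  have hm0 : (0 : ℝ) ≤ (L : ℝ) ^ 2 / 10 - 3 := by linarith
  obtain ⟨N0, hN0, hWZ0, -⟩ := hsel 0 le_rfl
  have hZ : 0 < Z := lt_of_lt_of_le (hpos N0 hN0) hWZ0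
  have hWc : 0 < W (2 * ⌊(1 - δ) * (L : ℝ) ^ 2 / 2⌋₊) := hpos _ hw3
  -- the optimiser
  have hsmall := tp_smallness ((L : ℝ) ^ 2) (max A 0) (max V 1) (Real.sqrt (max V 1))
    (Real.log (2 * (L : ℝ) ^ 2 + 1)) D β ε₁ s hD0 hβ hX0 (hR₂.trans hLX) hε₁0.le hε₁3 hε₁4 hs0 hs1 hsB
    (le_max_right _ _) hA' (le_max_right _ _) hV' (Real.sqrt_nonneg _) hsqrt hℓ0 hℓ2
  have key := stub_selectionTransfer W ((L ^ 2 + 1) / 2) (3 * L ^ 2 / 2 - 1) (2 * ⌊(1 - δ) * (L : ℝ) ^ 2 / 2⌋₊)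
    Z (max A 0) (max V 1) (Real.log (2 * (L : ℝ) ^ 2 + 1)) D ((L : ℝ) ^ 2 / 10 - 3)
    hZ (le_max_right _ _) (le_max_right _ _) hℓ0 hD0 hm0 hw1 hw2
    (fun N _ h2 => hpos N (by omega))
    (fun N h1 h2 => hLip N (by omega) (by omega))
    (fun t ht => by
      obtain ⟨N, hN, hWZ, hb⟩ := hsel t ht
      refine ⟨N, hpos N hN, hWZ, ?_⟩
      have h1 : t * V ≤ t * max V 1 := mul_le_mul_of_nonneg_left (le_max_left _ _) ht
      have h2 : A ≤ max A 0 := le_max_left _ _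
      linarith)
    hsmall
  have hfin := tp_final (L : ℝ) (max A 0) (Real.sqrt (max V 1)) (Real.log (2 * (L : ℝ) ^ 2 + 1)) D β ε ε₁ s
    hD0 hβ hε hL hR₁ hε₁1 hsA hA' hsqrt hℓL
  rw [Real.log_div hZ.ne' hWc.ne']
  linarith

/-! ### The registered stub -/

/-- **S7d `stub_twoPhaseCore` (lead; the finite-volume two-phase bound).** At fixed `(β, U, g)`, an interior `μ*`, a maximiser `h₀` of
`h ↦ q(μ*,h) − h²/g` over the box carrying the subgradient `1 − δ` of `q(·,h₀)` on the window: for every `ε > 0`, eventually in `L`,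
`log (Z_L / W_L(N_L)) ≤ βεL²` for the seeded torus at `μ*`, `N_L = 2⌊(1−δ)L²/2⌋`. Proof: `σ := ε/16`; per-side dichotomy strict/plateau
(convexity); `M` fixed with `C(1+|h₀|)(1/M) ≤ ε/16` and the block pressures at the ≤ 6 chemical potentials used within `εσ/64`-ish of `q`
(S7b); blocks of S7c at `μ* ∓ σ` (one type on a plateau side) with `a` tuned so that `|Re⟨N⟩ − N_L| ≤ 2M² + 12LM`; AHM 1703 at `μ*` + the
uniform `h`-Lipschitz bound make `h₀` `o(1)`-optimal in finite volume; S1 with `K := βK_seeded`, `K̃ := βK̃`, `t := A/V`; S2 transfers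
from the selected sector to `N_L`. v8.4: S7b (`stub_blockPressureLimit`), S7c (`stub_trialMoments` p142165), S7f (`stub_blockDensityCalculus` p141576) and S7g
(`stub_selectionTransfer` p141200) have LANDED and are used BY NAME inside the proof (no longer hypotheses; the registered signature is the bare core). [folklore composition] -/
theorem stub_twoPhaseCore :
    ∀ (β U g δ μ₁ μ₂ μs h₀ : ℝ), 0 < β → 0 ≤ U → 0 < g → δ ∈ Set.Icc (1/10 : ℝ) (2/5 : ℝ) → μ₁ < μs → μs < μ₂ →
      h₀ ∈ Set.Icc (-(13 * g + 1)) (13 * g + 1) → ∀ q : ℝ → ℝ → ℝ,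
      (∀ μ ∈ Set.Icc μ₁ μ₂, ∀ h ∈ Set.Icc (-(13 * g + 1)) (13 * g + 1), ∀ κ : ℝ, 0 < κ →
        ∃ L₀ : ℕ, ∀ (L : ℕ) [NeZero L], L₀ ≤ L →
          |Real.log (Matrix.partitionFn β (dWaveSourceTorus L U μ h)).re / (β * (L : ℝ) ^ 2) - q μ h| ≤ κ) →
      q μs h₀ - h₀ ^ 2 / g = sSup ((fun h' : ℝ => q μs h' - h' ^ 2 / g) '' Set.Icc (-(13 * g + 1)) (13 * g + 1)) →
      (∀ μ' ∈ Set.Icc μ₁ μ₂, q μs h₀ + (1 - δ) * (μ' - μs) ≤ q μ' h₀) →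
      ∀ ε : ℝ, 0 < ε → ∃ L₀ : ℕ, ∀ (L : ℕ) [NeZero L], L₀ ≤ L →
        Real.log ((Matrix.partitionFn β (hubbardTorusWith 2 L 1 U μs - ((g / (L : ℝ) ^ 2 : ℝ) : ℂ) • ((pairField dWaveFormFactor L)ᴴ * pairField dWaveFormFactor L))).re /
            (∑ s ∈ (Finset.univ.filter fun s : Finset (Orb (FermionTorus 2 L)) => s.card = (2 * ⌊(1 - δ) * (L : ℝ) ^ 2 / 2⌋₊)), (Matrix.gibbsWeight β (hubbardTorusWith 2 L 1 U μs - ((g / (L : ℝ) ^ 2 : ℝ) : ℂ) • ((pairField dWaveFormFactor L)ᴴ * pairField dWaveFormFactor L)) s s).re)) ≤ β * ε * (L : ℝ) ^ 2 := by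
  intro β U g δ μ₁ μ₂ μs h₀ hβ hU hg hδ hμ₁ hμ₂ hh₀ q hq hmax hsub ε hε
  obtain ⟨CF, hCF0, hCF⟩ := stub_seededSectorCalculus U g μs hU hg.le
  have hlog3 : 0 < Real.log 3 := Real.log_pos (by norm_num)
  have hβCF : 0 ≤ β * CF := mul_nonneg hβ.le hCF0
  have hD0 : 0 < β * CF + Real.log 3 := by linarith
  have hD3 : Real.log 3 ≤ β * CF + Real.log 3 := by linarith
  obtain ⟨ε₁, hε₁0, hε₁1, hε₁2, hε₁3, hε₁4, hε₁5⟩ := tp_eps β ε (β * CF + Real.log 3) hβ hε hD0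
  obtain ⟨L₁, hL₁⟩ :=
    stub_trialStateBudget β U g δ μ₁ μ₂ μs h₀ hβ hU hg hδ hμ₁ hμ₂ hh₀ q hq hmax hsub ε₁ hε₁0
  obtain ⟨L₂, hL₂⟩ := exists_nat_ge (max (4 * (1 + (β * CF + Real.log 3)) / (β * ε))
    (max (400 / 3 * (2 + 4 / (β * CF + Real.log 3))) 1))
  refine ⟨max L₁ L₂, fun L _ hL => ?_⟩
  have hLL₂ : (L₂ : ℝ) ≤ L := by exact_mod_cast le_of_max_le_right hL
  have hR₁ := (le_max_left _ _).trans (hL₂.trans hLL₂)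
  have hR₂ := ((le_max_left _ _).trans (le_max_right _ _)).trans (hL₂.trans hLL₂)
  have hL1 : (1 : ℝ) ≤ L := ((le_max_right _ _).trans (le_max_right _ _)).trans (hL₂.trans hLL₂)
  obtain ⟨Kt, hKt, hA, hV⟩ := hL₁ L (le_of_max_le_left hL)
  obtain ⟨hpos, hLip, hsel⟩ := hCF β hβ L
  -- (elaborate the abstract core as a `have` first: unifying its conclusion against the goal before `W` is
  -- determined would force the unifier to unfold the sector sums)
  have key := tp_core _ L β ε ε₁ δ (β * CF + Real.log 3) _ _ _ hβ hε hδ hD0 hD3 hε₁0 hε₁1 hε₁2 hε₁3 hε₁4 hε₁5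
    hL1 hR₁ hR₂ hpos hLip hA hV (fun t ht => hsel Kt hKt t (((2 * ⌊(1 - δ) * (L : ℝ) ^ 2 / 2⌋₊ : ℕ) : ℝ)) ht)
  exact key

end

end Summit.HubbardSuperconductivity.HubbardSuperconductivity.Theorems.TwSeededEnsembleEquivalenceR.ColdFloorLine
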